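/-
Copyright (c) 2026 the pub-hodgecm-mathlib formalisation cell (harness21).  Prover seat hodgecm-mathlib-K2E3-p37 (g4), Track B «K2-LIT» ∕ hLiu418
#184♮, Road I v3, unit U5 «THE CLOSE», FACE-D₀ rows `hfin₂`, route (B3) «GLOBAL UNFOLDING», file B3-2b: THE KERNEL SLICE AS A LATTICE SUM IN A Θ-FIXING
κ-MULTIPLIER MODEL, its Fourier coefficient by orthogonality (★ B3-1), and the SUPPORT COROLLARY «`cf_S ≠ 0 ⇒ ∃ ξ, Q ξ = S`» for skew `S`
(FACE-D₀ desk K2Liu-p02 (g10) DESK WORD #7, K2 bus 2026-09-05T03:25Z; LEAD F0P6-plan (g16) BATCH #274 (1)).  THEOREMS ONLY.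
-/
import Summits.HodgeConjecture.HodgeConjecture.Theorems.K2LiuDoubledLineThetaCoeffFubini             -- ★ p865063 B3-2a: `exists_cf_kernel_ne_zero_of_cf_thetaLift_ne_zero_at` (+ ★ (B4), ★ D8, ★ (D)∕(A1)∕(A2))
import Summits.HodgeConjecture.HodgeConjecture.Theorems.K2LiuCoveringWeightCharacterOrthogonality   -- ★ p865017 B3-1: `average_wt_smul_conj_unipDeltaChar_mul_unipDeltaChar_mul`
import Summits.HodgeConjecture.HodgeConjecture.Theorems.K2LiuLineThetaKernelMirror                  -- ★ `lineThetaKer_mk_eq_thetaDistLM` (the kernel in model currency)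
import Mathlib.MeasureTheory.Integral.DominatedConvergence
import HarnessLib

/-!
# K2_Liu road (hLiu418 = stmt-HodgeConjecture-24832), U5 «THE CLOSE», FACE-D₀ row `hfin₂`, route (B3) file B3-2b:
# `cf_S(θ_Φ((toDiagA ·)⁻¹Γ, yΓ))(1) = Σ_{ξ : Q ξ = S} (Tg ω(1, y⁻¹)Φ)(ξ)` — THE KERNEL SLICE UNFOLDED IN A Θ-FIXING κ-MULTIPLIER MODEL

Cell `pub/hodgecm-mathlib` (D-0151), Track B, build stream 29; helper lane `--supports stmt-HodgeConjecture-24832 --as helper`, count-neutral; closes no socket.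
THEOREMS ONLY (no `def`, no `instance`, no notation, no named-fact hypothesis, no `sorry`).

THE PLACE IN THE CHAIN (FACE-D₀ desk cut, K2 bus 03:25Z).  ★ B3-2a `K2LiuDoubledLineThetaCoeffFubini` reduced a non-zero coefficient `cf_S(Θ̃_Φ(fw))(h)`
to a non-zero coefficient AT `1` of a KERNEL SLICE `h′ ↦ θ_{Φ_h}((toDiagA h′)⁻¹Γ, q)`.  THIS FILE unfolds the kernel slice along `N_Δ(𝔸)`, HYPOTHESIS-FIRST on the
RATIONAL κ-MULTIPLIER MODEL — three named letters, paid by B3-2c-op (K2E3-p23: ★ p863642 ∘ ★ `coe_toOp_adelicSiegelLift` at the Θ-fixing lift of the line Cayley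
mover) and B3-2c-idx (K2Liu-p02: the index map `Q` and its global trace identity): `Tg : 𝒮(𝔸^{n″}) ≃ₗ 𝒮(𝔸^{n″})` with `hΘ : Θ_𝔸 ∘ Tg = Θ_𝔸`; `hmult` — in the
`Tg`-model `toDiagA u` (`u ∈ N_Δ(𝔸)`) acts ON RATIONAL EVALUATIONS by `ψ_{Q ξ}(u)`: `(Tg (ω(toDiagA u, 1) (Tg⁻¹ Ψ)))(ξ) = ψ_{Q ξ}(u) · Ψ(ξ)`; `hQskew` — the
`Q ξ` are rational `T_L`-skew.  Contents: §0 generic dominated-convergence step `integral_wt_smul_mul_tsum`; §1 **`thetaKer_slice_eq_tsum`** —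
`θ_Φ((toDiagA (u·1))⁻¹Γ, yΓ) = Σ' ξ, ψ_{Q ξ}(u) · (Tg (ω(1, y⁻¹)Φ))(ξ)` (★ `lineThetaKer_mk_eq_thetaDistLM`, the pair law, `hΘ`, ★ `thetaDist_def`, `hmult`);
§2 **`cf_kernel_eq_tsum_ite`** — for rational skew `S`, `0 < ∫⁻ βw < ∞`: `cf_S(θ_Φ((toDiagA ·)⁻¹Γ, yΓ))(1) = Σ' ξ, (if Q ξ = S then (Tg (ω(1, y⁻¹)Φ))(ξ) else 0)`
(★ (D) `fourierCoeffDelta_def`, §1, §0, ★ B3-1 `average_wt_smul_conj_unipDeltaChar_mul_unipDeltaChar_mul` termwise); §3 **`exists_index_eq_of_cf_thetaSide_ne_zero`**,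
**`hsupp_skew`** — THE SUPPORT COROLLARY, guarded as it must be (hermitian-type indices give the trivial character, ★ `unipDeltaChar_eq_one_of_herm`): for
`S ∈ skewMatrices c T_L`, `cf_S(Θ̃_Φ(fw))(h) ≠ 0 → ∃ ξ, Q ξ = S` (★ B3-2a `…_at` ∘ §2) — ★ B3-3 ED. 2 `hfib_of_indexMap_skew`'s `hsupp`, `T := fun Φ => Θ̃_Φ(fw)`.
HONEST LABEL: `hsign₂′`∕`hloc₂′` are NOT discharged here (`hΘ hmult hQskew` by value until B3-2c-op ∕ B3-2c-idx are ★); HC_CM is proved only modulo the 7 printed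
citations (2 remaining named inputs: hLiu418 = stmt-HodgeConjecture-24832, h413 = stmt-HodgeConjecture-24833) until rung 0 closes; count-neutral.

References: [Weil1964] A. Weil, Acta Math. 111 (1964), Chap. I n° 13 p. 160 (`𝐫₀` on the Siegel parabolic: chirps), Chap. III n° 41 Thm 6 p. 193 (`Θ(𝐫(σ)Φ) = Θ(Φ)`,
the theta series); [KudlaRallis1994] S. Kudla, S. Rallis, Ann. of Math. 140 (1994) §3; [Rallis1984] S. Rallis, Compositio Math. 51 (1984) §4; [MoeglinWaldspurger1995]
C. Mœglin, J.-L. Waldspurger, CUP (1995) I.2.6; [Kudla1994] S. Kudla, Israel J. Math. 87 (1994) §3; [Liu2021] Y. Liu, Camb. J. Math. 9 (2021) App. B Prop. B.8 p. 104.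
-/

set_option autoImplicit false
set_option linter.dupNamespace false
-- statements over the adelic dual-pair carriers elaborate to very large types; elaborate sequentially (as in ★ B3-2a ∕ ★ (B4))
set_option Elab.async false

noncomputable section

open NumberField MeasureTheory IsDedekindDomain Function
open scoped Matrix ComplexOrder ENNReal NNReal ComplexConjugate Classical  -- `Classical`: the `if Q ξ = S` of §2 (as ★ p863332)

namespace Summit.HodgeConjecture.HodgeConjecture.Cruxes.HLiu418.K2LiuDoubledLineThetaCoeffUnfolding

open Literature.NumberTheory.Automorphic Literature.NumberTheory.Automorphic.UnitaryGroup
open Literature.NumberTheory.Automorphic.IdeleClassGroup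
open Literature.NumberTheory.Automorphic.Liu2021
open Literature.NumberTheory.Automorphic.Liu2021.Def411WeilCarriers
open Literature.NumberTheory.Automorphic.Liu2021.Def411WeilCarriersDoubling
open Literature.NumberTheory.GelbartRogawski1991 Literature.NumberTheory.GelbartRogawski1991.UnitaryDualPair
open Literature.NumberTheory.GelbartRogawski1991.GRConstruction
open Literature.NumberTheory.GaloisRepresentations
open Literature.NumberTheory.Weil1964
open Literature.RepresentationTheory.Liu2021
open Literature.NumberTheory.K2Lit.DoubledLineTheta Literature.NumberTheory.K2Lit.SiegelDoubled
open Literature.MeasureTheory.Group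
open Summit.HodgeConjecture.HodgeConjecture.Cruxes.HLiu418.K2LiuSiegelUnipotentFourierDefs
open Summit.HodgeConjecture.HodgeConjecture.Cruxes.HLiu418.K2LiuSiegelUnipotentCharacters
open Summit.HodgeConjecture.HodgeConjecture.Cruxes.HLiu418.K2LiuUnipotentCoveringWeight
open Summit.HodgeConjecture.HodgeConjecture.Cruxes.HLiu418.K2LiuConstantTermDelta (enorm_wt_smul)
open Summit.HodgeConjecture.HodgeConjecture.Cruxes.HLiu418.K2LiuCoveringWeightCharacterOrthogonality
  (average_wt_smul_conj_unipDeltaChar_mul_unipDeltaChar_mul)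
open Summit.HodgeConjecture.HodgeConjecture.Cruxes.HLiu418.K2LiuLineThetaKernelMirror (lineThetaKer_mk_eq_thetaDistLM)
open Summit.HodgeConjecture.HodgeConjecture.Cruxes.HLiu418.K2LiuDoubledLineThetaCoeffFubini (exists_cf_kernel_ne_zero_of_cf_thetaLift_ne_zero_at)

variable (L : Type) [Field L] [NumberField L] [IsCMField L]
variable {N n : ℕ} (e : Fin N × Fin 1 ≃ Fin n)
  (dV : Fin N → L) (hdV : ∀ i, IsCMField.complexConj L (dV i) = dV i)
  (dW : Fin 1 → L) (hdW : ∀ i, IsCMField.complexConj L (dW i) = dW i)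
  {n'' : ℕ} (e₁ : Fin (n + n) × Fin 1 ≃ Fin n'')
  (hdV0 : ∀ i, dV i ≠ 0) (hdW0 : ∀ i, dW i ≠ 0)
  (lam : Literature.NumberTheory.Automorphic.IdeleClassGroup L →ₜ* Circle) (hlam : IsConjugateSymplectic L lam) (a' : (Fp L)ˣ)
  (hρ : HasThetaMajorants fun
      (p : ↥(UnitaryGroup.adelic (Fp L) L (IsCMField.complexConj L) (n + n) (Matrix.diagonal (dD L e dV hdV dW hdW))) ×
        ↥(UnitaryGroup.adelic (Fp L) L (IsCMField.complexConj L) 1 (JW (Fp L) L a')))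
      (Φ : piSchwartzBruhat (Fp L) (Fin n'')) =>
        pairRep (Fp L) L (IsCMField.complexConj L) (n + n) 1 e₁ (Matrix.diagonal (dD L e dV hdV dW hdW)) (JW (Fp L) L a')
          (chiSplittingLine L e₁ (dD L e dV hdV dW hdW) (dD_conj L e dV hdV dW hdW) (dD_ne_zero L e dV hdV dW hdW hdV0 hdW0)
            (toHeckeCharacter L lam) (isUnitary_toHeckeCharacter L lam)
            ((isOscillatorChar_toHeckeCharacter_iff lam).mpr hlam) (TW (Fp L) a')
            (isUnit_det_TW (Fp L) a') (JW (Fp L) L a') (JW_eq (Fp L) L a'))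
          p Φ)
  [MeasurableSpace (↥(UnitaryGroup.adelic (Fp L) L (IsCMField.complexConj L) 1 (JW (Fp L) L a')) ⧸
    (UnitaryGroup.toAdelic (Fp L) L (IsCMField.complexConj L) 1 (JW (Fp L) L a')).range)]
  [BorelSpace (↥(UnitaryGroup.adelic (Fp L) L (IsCMField.complexConj L) 1 (JW (Fp L) L a')) ⧸
    (UnitaryGroup.toAdelic (Fp L) L (IsCMField.complexConj L) 1 (JW (Fp L) L a')).range)]
  (μW : Measure (↥(UnitaryGroup.adelic (Fp L) L (IsCMField.complexConj L) 1 (JW (Fp L) L a')) ⧸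
    (UnitaryGroup.toAdelic (Fp L) L (IsCMField.complexConj L) 1 (JW (Fp L) L a')).range)) [IsFiniteMeasure μW]
  (fw : C(↥(UnitaryGroup.adelic (Fp L) L (IsCMField.complexConj L) 1 (JW (Fp L) L a')) ⧸
    (UnitaryGroup.toAdelic (Fp L) L (IsCMField.complexConj L) 1 (JW (Fp L) L a')).range, ℂ))
  [MeasurableSpace (unipDelta L e dV hdV dW hdW)] [BorelSpace (unipDelta L e dV hdV dW hdW)]
  (νN : Measure (unipDelta L e dV hdV dW hdW)) [νN.IsHaarMeasure]
  {βw : unipDelta L e dV hdV dW hdW → ℝ≥0∞} (hβ : IsCoveringWeight (unipDeltaRat L e dV hdV dW hdW) βw)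
  (hβ0 : ∫⁻ u, βw u ∂νN ≠ 0) (hβtop : ∫⁻ u, βw u ∂νN ≠ ∞)
  {K : Set (unipDelta L e dV hdV dW hdW)} (hK : IsCompact K) (hβK : ∀ u, βw u ≤ K.indicator 1 u)
  -- THE RATIONAL κ-MULTIPLIER MODEL (letters of B3-2c-op ∕ B3-2c-idx)
  (Tg : ↥(piSchwartzBruhat (Fp L) (Fin n'')) ≃ₗ[ℂ] ↥(piSchwartzBruhat (Fp L) (Fin n'')))
  (hΘ : ∀ Ψ : piSchwartzBruhat (Fp L) (Fin n''), thetaDistLM (Fp L) (Fin n'') (Tg Ψ) = thetaDistLM (Fp L) (Fin n'') Ψ)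
  (Q : (Fin n'' → Fp L) → Matrix (Fin n) (Fin n) L)
  (hmult : ∀ (u : ↥(unipDelta L e dV hdV dW hdW)) (Ψ : ↥(piSchwartzBruhat (Fp L) (Fin n''))) (ξ : Fin n'' → Fp L),
    ((Tg (pairRep (Fp L) L (IsCMField.complexConj L) (n + n) 1 e₁ (Matrix.diagonal (dD L e dV hdV dW hdW)) (JW (Fp L) L a')
        (chiSplittingLine L e₁ (dD L e dV hdV dW hdW) (dD_conj L e dV hdV dW hdW) (dD_ne_zero L e dV hdV dW hdW hdV0 hdW0)
          (toHeckeCharacter L lam) (isUnitary_toHeckeCharacter L lam)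
          ((isOscillatorChar_toHeckeCharacter_iff lam).mpr hlam) (TW (Fp L) a')
          (isUnit_det_TW (Fp L) a') (JW (Fp L) L a') (JW_eq (Fp L) L a'))
        (toDiagA L e dV hdV dW hdW (u : HA L e dV hdV dW hdW), 1) (Tg.symm Ψ)) : ↥(piSchwartzBruhat (Fp L) (Fin n''))) :
          (Fin n'' → AdeleRing (𝓞 (Fp L)) (Fp L)) → ℂ) (ratPt (Fp L) (Fin n'') ξ) =
      (unipDeltaChar L e dV hdV dW hdW (Q ξ) (u : HA L e dV hdV dW hdW) : ℂ) *
        ((Ψ : ↥(piSchwartzBruhat (Fp L) (Fin n''))) : (Fin n'' → AdeleRing (𝓞 (Fp L)) (Fp L)) → ℂ) (ratPt (Fp L) (Fin n'') ξ))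
  (hQskew : ∀ ξ : Fin n'' → Fp L,
    Q ξ ∈ skewMatrices ((IsCMField.complexConj L : L ≃ₐ[Fp L] L) : L →+* L) ((gramR L e dV hdV dW hdW).map (algebraMap (Fp L) L)))
  (S : Matrix (Fin n) (Fin n) L)

/-! ## §0 Generic: a weighted integral of an absolutely convergent multiplier series, term by term -/

section Generic

variable {X ι : Type*} [MeasurableSpace X] [Countable ι] (μ : Measure X)

/-- **`∫ w • (a · Σ'ᵢ χᵢ cᵢ) = Σ'ᵢ ∫ w • (a · (χᵢ cᵢ))`** for a weight `w ≤ 1` of finite mass, factors `a`, `χᵢ` of norm `≤ 1` and absolutely summable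
coefficients `cᵢ` (dominated convergence: the `i`-th summand has `L¹`-norm `≤ |cᵢ| · ∫⁻ w`). [folklore] -/
theorem integral_wt_smul_mul_tsum {w : X → ℝ≥0∞} (hw : Measurable w) (hw1 : ∀ x, w x ≤ 1) (hwtop : ∫⁻ x, w x ∂μ ≠ ∞)
    {a : X → ℂ} (ham : AEStronglyMeasurable a μ) (ha : ∀ x, ‖a x‖ ≤ 1)
    {χ : ι → X → ℂ} (hχm : ∀ i, AEStronglyMeasurable (χ i) μ) (hχ : ∀ i x, ‖χ i x‖ ≤ 1)
    {c : ι → ℂ} (hc : Summable fun i => ‖c i‖) :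
    ∫ x, (w x).toReal • (a x * ∑' i, χ i x * c i) ∂μ = ∑' i, ∫ x, (w x).toReal • (a x * (χ i x * c i)) ∂μ := by
  -- norm of a summand
  have hn : ∀ i x, ‖a x * (χ i x * c i)‖ ≤ ‖c i‖ := fun i x => by
    rw [norm_mul, norm_mul]
    calc ‖a x‖ * (‖χ i x‖ * ‖c i‖) ≤ 1 * (1 * ‖c i‖) := by
          gcongr
          · exact ha x
          · exact hχ i x
      _ = ‖c i‖ := by rw [one_mul, one_mul]
  have hsum : ∀ x, Summable fun i => a x * (χ i x * c i) := fun x => Summable.of_norm_bounded hc (hn · x)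
  have h1 : ∀ x, (w x).toReal • (a x * ∑' i, χ i x * c i) = ∑' i, (w x).toReal • (a x * (χ i x * c i)) := fun x => by
    rw [← tsum_mul_left, ← (hsum x).tsum_const_smul]
  simp_rw [h1]
  refine integral_tsum (fun i => hw.ennreal_toReal.aestronglyMeasurable.smul (ham.mul ((hχm i).mul aestronglyMeasurable_const))) ?_
  -- `∑' i, ∫⁻ ‖…‖ₑ ≤ (∑' i, ‖c i‖ₑ) · ∫⁻ w < ∞`
  have hwx : ∀ x, w x ≠ ∞ := fun x => ne_top_of_le_ne_top ENNReal.one_ne_top (hw1 x)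
  have hle : ∀ i x, ‖(w x).toReal • (a x * (χ i x * c i))‖ₑ ≤ ‖c i‖ₑ * w x := fun i x => by
    rw [enorm_smul, Real.enorm_eq_ofReal ENNReal.toReal_nonneg, ENNReal.ofReal_toReal (hwx x), mul_comm, ← ofReal_norm, ← ofReal_norm]
    gcongr
    exact hn i x
  have hcs : (∑' i, ‖c i‖ₑ) ≠ ∞ := by
    have h : Summable fun i => ‖c i‖₊ := NNReal.summable_coe.1 (by simpa only [coe_nnnorm] using hc)
    simpa only [enorm_eq_nnnorm] using ENNReal.tsum_coe_ne_top_iff_summable.2 h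
  refine ne_top_of_le_ne_top (ENNReal.mul_ne_top hcs hwtop) ?_
  rw [← ENNReal.tsum_mul_right]
  refine ENNReal.tsum_le_tsum fun i => ?_
  calc ∫⁻ x, ‖(w x).toReal • (a x * (χ i x * c i))‖ₑ ∂μ ≤ ∫⁻ x, ‖c i‖ₑ * w x ∂μ := lintegral_mono fun x => hle i x
    _ = ‖c i‖ₑ * ∫⁻ x, w x ∂μ := lintegral_const_mul _ hw

end Generic

/-! ## §1 The kernel slice as a lattice sum -/

include hΘ hmult

omit [MeasurableSpace (↥(UnitaryGroup.adelic (Fp L) L (IsCMField.complexConj L) 1 (JW (Fp L) L a')) ⧸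
    (UnitaryGroup.toAdelic (Fp L) L (IsCMField.complexConj L) 1 (JW (Fp L) L a')).range)]
  [BorelSpace (↥(UnitaryGroup.adelic (Fp L) L (IsCMField.complexConj L) 1 (JW (Fp L) L a')) ⧸
    (UnitaryGroup.toAdelic (Fp L) L (IsCMField.complexConj L) 1 (JW (Fp L) L a')).range)]
  [IsFiniteMeasure μW] [MeasurableSpace (unipDelta L e dV hdV dW hdW)] [BorelSpace (unipDelta L e dV hdV dW hdW)] [νN.IsHaarMeasure] in
set_option maxHeartbeats 4000000 in -- measured: 1000000 RED (`isDefEq` in the `pairRep_apply` rewrite `hb` on the line datum's telescope), 4000000 GREEN (as ★ FaceDefs)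
/-- **THE KERNEL SLICE IS A LATTICE SUM WITH THE MULTIPLIERS `ψ_{Q ξ}`**: for `u ∈ N_Δ(𝔸)` and `y ∈ U(⟨a′⟩)(𝔸)`,
`θ_Φ((toDiagA (u·1))⁻¹Γ, yΓ) = Σ' ξ, ψ_{Q ξ}(u) · (Tg (ω(1, y⁻¹)Φ))(ξ)` — the kernel is `Θ_𝔸(ω(toDiagA u, y⁻¹)Φ)` (★ `lineThetaKer_mk_eq_thetaDistLM`),
`ω(toDiagA u, y⁻¹) = ω(toDiagA u, 1) ∘ ω(1, y⁻¹)`, `Θ_𝔸 = Θ_𝔸 ∘ Tg` (`hΘ`), `Θ_𝔸(Ψ) = Σ_ξ Ψ(ξ)` (★ `thetaDist_def`) and `hmult` termwise.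
[cite: Weil1964, Chap. III n° 41 Thm 6 p. 193] [cite: KudlaRallis1994, §3] [cite: Kudla1994, §3] -/
theorem thetaKer_slice_eq_tsum (Φ : piSchwartzBruhat (Fp L) (Fin n'')) (u : ↥(unipDelta L e dV hdV dW hdW))
    (y : ↥(UnitaryGroup.adelic (Fp L) L (IsCMField.complexConj L) 1 (JW (Fp L) L a'))) :
    (lineThetaKernelDatum L (n + n) e₁ (dD L e dV hdV dW hdW) (dD_conj L e dV hdV dW hdW)
        (dD_ne_zero L e dV hdV dW hdW hdV0 hdW0) lam hlam a' hρ).thetaKer Φ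
        (QuotientGroup.mk (toDiagA L e dV hdV dW hdW ((u : HA L e dV hdV dW hdW) * 1))⁻¹, QuotientGroup.mk y) =
      ∑' ξ : Fin n'' → Fp L, (unipDeltaChar L e dV hdV dW hdW (Q ξ) (u : HA L e dV hdV dW hdW) : ℂ) *
        ((Tg (pairRep (Fp L) L (IsCMField.complexConj L) (n + n) 1 e₁ (Matrix.diagonal (dD L e dV hdV dW hdW)) (JW (Fp L) L a')
            (chiSplittingLine L e₁ (dD L e dV hdV dW hdW) (dD_conj L e dV hdV dW hdW) (dD_ne_zero L e dV hdV dW hdW hdV0 hdW0)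
              (toHeckeCharacter L lam) (isUnitary_toHeckeCharacter L lam)
              ((isOscillatorChar_toHeckeCharacter_iff lam).mpr hlam) (TW (Fp L) a')
              (isUnit_det_TW (Fp L) a') (JW (Fp L) L a') (JW_eq (Fp L) L a'))
            (1, y⁻¹) Φ) : ↥(piSchwartzBruhat (Fp L) (Fin n''))) : (Fin n'' → AdeleRing (𝓞 (Fp L)) (Fp L)) → ℂ)
          (ratPt (Fp L) (Fin n'') ξ) := by
  -- Every step is an explicit `Eq.trans` on small goals: the line datum's carriers are too large for `rw` inside the main goal.
  -- (0) `u · 1 = u` inside the kernel's first variable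
  have h0 : (lineThetaKernelDatum L (n + n) e₁ (dD L e dV hdV dW hdW) (dD_conj L e dV hdV dW hdW)
        (dD_ne_zero L e dV hdV dW hdW hdV0 hdW0) lam hlam a' hρ).thetaKer Φ
        (QuotientGroup.mk (toDiagA L e dV hdV dW hdW ((u : HA L e dV hdV dW hdW) * 1))⁻¹, QuotientGroup.mk y) =
      (lineThetaKernelDatum L (n + n) e₁ (dD L e dV hdV dW hdW) (dD_conj L e dV hdV dW hdW)
        (dD_ne_zero L e dV hdV dW hdW hdV0 hdW0) lam hlam a' hρ).thetaKer Φ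
        (QuotientGroup.mk (toDiagA L e dV hdV dW hdW (u : HA L e dV hdV dW hdW))⁻¹, QuotientGroup.mk y) := by
    rw [mul_one]
  -- (1) the kernel at representatives, in model currency (★ layer (c0)): `θ_Φ(xΓ, yΓ) = Θ_𝔸(ω_T(s(inl x⁻¹ · inr y⁻¹)) Φ)`
  have h1 := lineThetaKer_mk_eq_thetaDistLM L (n + n) e₁ (dD L e dV hdV dW hdW) (dD_conj L e dV hdV dW hdW)
    (dD_ne_zero L e dV hdV dW hdW hdV0 hdW0) lam hlam a' hρ Φ (toDiagA L e dV hdV dW hdW (u : HA L e dV hdV dW hdW))⁻¹ y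
  -- (2) `ω_T(s(inl x · inr y⁻¹)) Φ = ω(x, y⁻¹) Φ` (★ `pairRep_apply` ∕ `pairSplitting_apply`, read backwards)
  have hb : pairRep (Fp L) L (IsCMField.complexConj L) (n + n) 1 e₁ (Matrix.diagonal (dD L e dV hdV dW hdW)) (JW (Fp L) L a')
            (chiSplittingLine L e₁ (dD L e dV hdV dW hdW) (dD_conj L e dV hdV dW hdW) (dD_ne_zero L e dV hdV dW hdW hdV0 hdW0)
              (toHeckeCharacter L lam) (isUnitary_toHeckeCharacter L lam)
              ((isOscillatorChar_toHeckeCharacter_iff lam).mpr hlam) (TW (Fp L) a')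
              (isUnit_det_TW (Fp L) a') (JW (Fp L) L a') (JW_eq (Fp L) L a'))
          ((toDiagA L e dV hdV dW hdW (u : HA L e dV hdV dW hdW))⁻¹⁻¹, y⁻¹) Φ =
      adelicMpCont.omega (Fp L) (Fin n'') (adelicGram (Fp L) e₁ (realDiagonal L (dD L e dV hdV dW hdW) (dD_conj L e dV hdV dW hdW)) (TW (Fp L) a'))
        (chiSplittingLine L e₁ (dD L e dV hdV dW hdW) (dD_conj L e dV hdV dW hdW) (dD_ne_zero L e dV hdV dW hdW hdV0 hdW0)
          (toHeckeCharacter L lam) (isUnitary_toHeckeCharacter L lam)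
          ((isOscillatorChar_toHeckeCharacter_iff lam).mpr hlam) (TW (Fp L) a') (isUnit_det_TW (Fp L) a') (JW (Fp L) L a') (JW_eq (Fp L) L a')
          (UnitaryGroup.adelicInl (Fp L) L (IsCMField.complexConj L) (n + n) 1 (Matrix.diagonal (dD L e dV hdV dW hdW)) (JW (Fp L) L a')
              (toDiagA L e dV hdV dW hdW (u : HA L e dV hdV dW hdW))⁻¹⁻¹ *
            UnitaryGroup.adelicInr (Fp L) L (IsCMField.complexConj L) (n + n) 1 (Matrix.diagonal (dD L e dV hdV dW hdW)) (JW (Fp L) L a') y⁻¹)) Φ := by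
    rw [pairRep_apply, pairSplitting_apply]
  -- (3) `x⁻¹⁻¹ = x`
  have hc : pairRep (Fp L) L (IsCMField.complexConj L) (n + n) 1 e₁ (Matrix.diagonal (dD L e dV hdV dW hdW)) (JW (Fp L) L a')
            (chiSplittingLine L e₁ (dD L e dV hdV dW hdW) (dD_conj L e dV hdV dW hdW) (dD_ne_zero L e dV hdV dW hdW hdV0 hdW0)
              (toHeckeCharacter L lam) (isUnitary_toHeckeCharacter L lam)
              ((isOscillatorChar_toHeckeCharacter_iff lam).mpr hlam) (TW (Fp L) a')
              (isUnit_det_TW (Fp L) a') (JW (Fp L) L a') (JW_eq (Fp L) L a'))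
          ((toDiagA L e dV hdV dW hdW (u : HA L e dV hdV dW hdW))⁻¹⁻¹, y⁻¹) Φ =
      pairRep (Fp L) L (IsCMField.complexConj L) (n + n) 1 e₁ (Matrix.diagonal (dD L e dV hdV dW hdW)) (JW (Fp L) L a')
            (chiSplittingLine L e₁ (dD L e dV hdV dW hdW) (dD_conj L e dV hdV dW hdW) (dD_ne_zero L e dV hdV dW hdW hdV0 hdW0)
              (toHeckeCharacter L lam) (isUnitary_toHeckeCharacter L lam)
              ((isOscillatorChar_toHeckeCharacter_iff lam).mpr hlam) (TW (Fp L) a')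
              (isUnit_det_TW (Fp L) a') (JW (Fp L) L a') (JW_eq (Fp L) L a'))
          (toDiagA L e dV hdV dW hdW (u : HA L e dV hdV dW hdW), y⁻¹) Φ := by
    rw [inv_inv]
  -- (4) the pair law `ω(toDiagA u, y⁻¹) = ω(toDiagA u, 1) ∘ ω(1, y⁻¹)` (forward rewrites only)
  have hprod : ((toDiagA L e dV hdV dW hdW (u : HA L e dV hdV dW hdW),
        (1 : ↥(UnitaryGroup.adelic (Fp L) L (IsCMField.complexConj L) 1 (JW (Fp L) L a')))) * (1, y⁻¹)) =
      (toDiagA L e dV hdV dW hdW (u : HA L e dV hdV dW hdW), y⁻¹) := by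
    rw [Prod.mk_mul_mk, mul_one, one_mul]
  have happ : pairRep (Fp L) L (IsCMField.complexConj L) (n + n) 1 e₁ (Matrix.diagonal (dD L e dV hdV dW hdW)) (JW (Fp L) L a')
            (chiSplittingLine L e₁ (dD L e dV hdV dW hdW) (dD_conj L e dV hdV dW hdW) (dD_ne_zero L e dV hdV dW hdW hdV0 hdW0)
              (toHeckeCharacter L lam) (isUnitary_toHeckeCharacter L lam)
              ((isOscillatorChar_toHeckeCharacter_iff lam).mpr hlam) (TW (Fp L) a')
              (isUnit_det_TW (Fp L) a') (JW (Fp L) L a') (JW_eq (Fp L) L a'))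
          (toDiagA L e dV hdV dW hdW (u : HA L e dV hdV dW hdW), y⁻¹) Φ =
      pairRep (Fp L) L (IsCMField.complexConj L) (n + n) 1 e₁ (Matrix.diagonal (dD L e dV hdV dW hdW)) (JW (Fp L) L a')
            (chiSplittingLine L e₁ (dD L e dV hdV dW hdW) (dD_conj L e dV hdV dW hdW) (dD_ne_zero L e dV hdV dW hdW hdV0 hdW0)
              (toHeckeCharacter L lam) (isUnitary_toHeckeCharacter L lam)
              ((isOscillatorChar_toHeckeCharacter_iff lam).mpr hlam) (TW (Fp L) a')
              (isUnit_det_TW (Fp L) a') (JW (Fp L) L a') (JW_eq (Fp L) L a'))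
          (toDiagA L e dV hdV dW hdW (u : HA L e dV hdV dW hdW), 1)
        (pairRep (Fp L) L (IsCMField.complexConj L) (n + n) 1 e₁ (Matrix.diagonal (dD L e dV hdV dW hdW)) (JW (Fp L) L a')
            (chiSplittingLine L e₁ (dD L e dV hdV dW hdW) (dD_conj L e dV hdV dW hdW) (dD_ne_zero L e dV hdV dW hdW hdV0 hdW0)
              (toHeckeCharacter L lam) (isUnitary_toHeckeCharacter L lam)
              ((isOscillatorChar_toHeckeCharacter_iff lam).mpr hlam) (TW (Fp L) a')
              (isUnit_det_TW (Fp L) a') (JW (Fp L) L a') (JW_eq (Fp L) L a'))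
            (1, y⁻¹) Φ) := by
    rw [← hprod, map_mul, Module.End.mul_apply]
  -- (5) insert `Tg⁻¹ Tg`
  have hvec := hb.symm.trans (hc.trans (happ.trans (congrArg
    (pairRep (Fp L) L (IsCMField.complexConj L) (n + n) 1 e₁ (Matrix.diagonal (dD L e dV hdV dW hdW)) (JW (Fp L) L a')
            (chiSplittingLine L e₁ (dD L e dV hdV dW hdW) (dD_conj L e dV hdV dW hdW) (dD_ne_zero L e dV hdV dW hdW hdV0 hdW0)
              (toHeckeCharacter L lam) (isUnitary_toHeckeCharacter L lam)
              ((isOscillatorChar_toHeckeCharacter_iff lam).mpr hlam) (TW (Fp L) a')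
              (isUnit_det_TW (Fp L) a') (JW (Fp L) L a') (JW_eq (Fp L) L a'))
          (toDiagA L e dV hdV dW hdW (u : HA L e dV hdV dW hdW), 1))
    (Tg.symm_apply_apply (pairRep (Fp L) L (IsCMField.complexConj L) (n + n) 1 e₁ (Matrix.diagonal (dD L e dV hdV dW hdW)) (JW (Fp L) L a')
            (chiSplittingLine L e₁ (dD L e dV hdV dW hdW) (dD_conj L e dV hdV dW hdW) (dD_ne_zero L e dV hdV dW hdW hdV0 hdW0)
              (toHeckeCharacter L lam) (isUnitary_toHeckeCharacter L lam)
              ((isOscillatorChar_toHeckeCharacter_iff lam).mpr hlam) (TW (Fp L) a')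
              (isUnit_det_TW (Fp L) a') (JW (Fp L) L a') (JW_eq (Fp L) L a'))
            (1, y⁻¹) Φ)).symm)))
  -- (6) chain: kernel = Θ_𝔸(…) = Θ_𝔸(Tg (…)) = Σ_ξ (Tg (…))(ξ) = Σ_ξ ψ_{Q ξ}(u) · Ψ(ξ)
  refine h0.trans (h1.trans (((congrArg (thetaDistLM (Fp L) (Fin n'')) hvec).trans (hΘ _).symm).trans ?_))
  refine (thetaDistLM_apply _).trans ((thetaDist_def _).trans ?_)
  exact tsum_congr fun ξ => hmult u _ ξ

omit [MeasurableSpace (↥(UnitaryGroup.adelic (Fp L) L (IsCMField.complexConj L) 1 (JW (Fp L) L a')) ⧸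
    (UnitaryGroup.toAdelic (Fp L) L (IsCMField.complexConj L) 1 (JW (Fp L) L a')).range)]
  [BorelSpace (↥(UnitaryGroup.adelic (Fp L) L (IsCMField.complexConj L) 1 (JW (Fp L) L a')) ⧸
    (UnitaryGroup.toAdelic (Fp L) L (IsCMField.complexConj L) 1 (JW (Fp L) L a')).range)]
  [IsCMField L] [IsFiniteMeasure μW] [MeasurableSpace (unipDelta L e dV hdV dW hdW)] [BorelSpace (unipDelta L e dV hdV dW hdW)] [νN.IsHaarMeasure] hΘ hmult in
/-- the coefficients of the lattice sum are absolutely summable: `Σ_ξ |(Tg Ψ)(ξ)| < ∞` (a Schwartz–Bruhat function restricted to the rational points,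
★ `summable_norm_ratPt`). [cite: Weil1964, Chap. III n° 41 Lemme 5 p. 192] -/
theorem summable_norm_coeff (Ψ : piSchwartzBruhat (Fp L) (Fin n'')) :
    Summable fun ξ : Fin n'' → Fp L =>
      ‖((Tg Ψ : ↥(piSchwartzBruhat (Fp L) (Fin n''))) : (Fin n'' → AdeleRing (𝓞 (Fp L)) (Fp L)) → ℂ) (ratPt (Fp L) (Fin n'') ξ)‖ :=
  summable_norm_ratPt (Tg Ψ).2

/-! ## §2 The Fourier coefficient of the kernel slice: orthogonality termwise -/

include hβ hβ0 hβtop hK hβK hQskew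

omit [MeasurableSpace (↥(UnitaryGroup.adelic (Fp L) L (IsCMField.complexConj L) 1 (JW (Fp L) L a')) ⧸
    (UnitaryGroup.toAdelic (Fp L) L (IsCMField.complexConj L) 1 (JW (Fp L) L a')).range)]
  [BorelSpace (↥(UnitaryGroup.adelic (Fp L) L (IsCMField.complexConj L) 1 (JW (Fp L) L a')) ⧸
    (UnitaryGroup.toAdelic (Fp L) L (IsCMField.complexConj L) 1 (JW (Fp L) L a')).range)]
  [IsFiniteMeasure μW] hK hβK in
set_option maxHeartbeats 1000000 in -- idem
/-- **B3-2b — THE FOURIER COEFFICIENT OF THE KERNEL SLICE, UNFOLDED**: for a rational `T_L`-skew index `S` and a covering weight of mass `0 < ∫⁻ βw < ∞`,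
`cf_S(h ↦ θ_Φ((toDiagA h)⁻¹Γ, yΓ))(1) = Σ' ξ, (if Q ξ = S then (Tg (ω(1, y⁻¹)Φ))(ξ) else 0)` — ★ (D) `fourierCoeffDelta_def`, §1 under the integral sign,
§0 (dominated convergence: the summands are dominated by `βw(u) · |c_ξ|`, `Σ_ξ |c_ξ| < ∞`), and ★ B3-1 `average_wt_smul_conj_unipDeltaChar_mul_unipDeltaChar_mul`
termwise (orthogonality of the characters `ψ_S`, `ψ_{Q ξ}` of the compact quotient `N_Δ(L⁺)∖N_Δ(𝔸)`, both indices rational skew).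
[cite: KudlaRallis1994, §3] [cite: MoeglinWaldspurger1995, I.2.6] [cite: Weil1964, Chap. III n° 41 Thm 6 p. 193] -/
theorem cf_kernel_eq_tsum_ite
    (hS : S ∈ skewMatrices ((IsCMField.complexConj L : L ≃ₐ[Fp L] L) : L →+* L) ((gramR L e dV hdV dW hdW).map (algebraMap (Fp L) L)))
    (Φ : piSchwartzBruhat (Fp L) (Fin n'')) (y : ↥(UnitaryGroup.adelic (Fp L) L (IsCMField.complexConj L) 1 (JW (Fp L) L a'))) :
    fourierCoeffDelta L e dV hdV dW hdW νN βw S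
        (fun h => (lineThetaKernelDatum L (n + n) e₁ (dD L e dV hdV dW hdW) (dD_conj L e dV hdV dW hdW)
            (dD_ne_zero L e dV hdV dW hdW hdV0 hdW0) lam hlam a' hρ).thetaKer Φ
          (QuotientGroup.mk (toDiagA L e dV hdV dW hdW h)⁻¹, QuotientGroup.mk y)) 1 =
      ∑' ξ : Fin n'' → Fp L, if Q ξ = S then
        ((Tg (pairRep (Fp L) L (IsCMField.complexConj L) (n + n) 1 e₁ (Matrix.diagonal (dD L e dV hdV dW hdW)) (JW (Fp L) L a')
            (chiSplittingLine L e₁ (dD L e dV hdV dW hdW) (dD_conj L e dV hdV dW hdW) (dD_ne_zero L e dV hdV dW hdW hdV0 hdW0)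
              (toHeckeCharacter L lam) (isUnitary_toHeckeCharacter L lam)
              ((isOscillatorChar_toHeckeCharacter_iff lam).mpr hlam) (TW (Fp L) a')
              (isUnit_det_TW (Fp L) a') (JW (Fp L) L a') (JW_eq (Fp L) L a'))
            (1, y⁻¹) Φ) : ↥(piSchwartzBruhat (Fp L) (Fin n''))) : (Fin n'' → AdeleRing (𝓞 (Fp L)) (Fp L)) → ℂ)
          (ratPt (Fp L) (Fin n'') ξ) else 0 := by
  haveI : Countable (Fp L) := NumberField.countable' (K := Fp L)
  -- unfold `cf_S` and the kernel slice (§1) under the integral sign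
  rw [fourierCoeffDelta_def]
  simp_rw [thetaKer_slice_eq_tsum L e dV hdV dW hdW e₁ hdV0 hdW0 lam hlam a' hρ Tg hΘ Q hmult Φ]
  -- term by term (§0): weight `βw ≤ 1` of finite mass, `|conj ψ_S| = |ψ_{Q ξ}| = 1`, `Σ_ξ |c_ξ| < ∞`
  have hT := integral_wt_smul_mul_tsum νN hβ.1 hβ.le_one hβtop
    (a := fun u : ↥(unipDelta L e dV hdV dW hdW) => conj (unipDeltaChar L e dV hdV dW hdW S (u : HA L e dV hdV dW hdW) : ℂ))
    ((Complex.continuous_conj.comp (continuous_unipDeltaChar_coe L e dV hdV dW hdW S)).aestronglyMeasurable)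
    (fun u => by rw [RCLike.norm_conj, Circle.norm_coe])
    (χ := fun (ξ : Fin n'' → Fp L) (u : ↥(unipDelta L e dV hdV dW hdW)) => (unipDeltaChar L e dV hdV dW hdW (Q ξ) (u : HA L e dV hdV dW hdW) : ℂ))
    (fun ξ => (continuous_unipDeltaChar_coe L e dV hdV dW hdW (Q ξ)).aestronglyMeasurable)
    (fun ξ u => by rw [Circle.norm_coe])
    (c := fun ξ : Fin n'' → Fp L =>
      ((Tg (pairRep (Fp L) L (IsCMField.complexConj L) (n + n) 1 e₁ (Matrix.diagonal (dD L e dV hdV dW hdW)) (JW (Fp L) L a')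
            (chiSplittingLine L e₁ (dD L e dV hdV dW hdW) (dD_conj L e dV hdV dW hdW) (dD_ne_zero L e dV hdV dW hdW hdV0 hdW0)
              (toHeckeCharacter L lam) (isUnitary_toHeckeCharacter L lam)
              ((isOscillatorChar_toHeckeCharacter_iff lam).mpr hlam) (TW (Fp L) a')
              (isUnit_det_TW (Fp L) a') (JW (Fp L) L a') (JW_eq (Fp L) L a'))
            (1, y⁻¹) Φ) : ↥(piSchwartzBruhat (Fp L) (Fin n''))) : (Fin n'' → AdeleRing (𝓞 (Fp L)) (Fp L)) → ℂ) (ratPt (Fp L) (Fin n'') ξ))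
    (summable_norm_coeff L Tg _)
  refine (congrArg (fun z : ℂ => ((∫⁻ u, βw u ∂νN).toReal⁻¹ : ℝ) • z) hT).trans ?_
  rw [← tsum_const_smul'' (((∫⁻ u, βw u ∂νN).toReal⁻¹ : ℝ))]
  -- orthogonality of `ψ_S`, `ψ_{Q ξ}` termwise (★ B3-1)
  refine tsum_congr fun ξ => ?_
  rw [average_wt_smul_conj_unipDeltaChar_mul_unipDeltaChar_mul L e dV hdV dW hdW hdV0 hdW0 νN hβ hβ0 hβtop hS (hQskew ξ)]
  by_cases h : Q ξ = S
  · rw [if_pos h, if_pos h.symm]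
  · rw [if_neg h, if_neg (Ne.symm h)]

/-! ## §3 The support corollaries (rational skew indices) -/

omit [MeasurableSpace (↥(UnitaryGroup.adelic (Fp L) L (IsCMField.complexConj L) 1 (JW (Fp L) L a')) ⧸
    (UnitaryGroup.toAdelic (Fp L) L (IsCMField.complexConj L) 1 (JW (Fp L) L a')).range)]
  [BorelSpace (↥(UnitaryGroup.adelic (Fp L) L (IsCMField.complexConj L) 1 (JW (Fp L) L a')) ⧸
    (UnitaryGroup.toAdelic (Fp L) L (IsCMField.complexConj L) 1 (JW (Fp L) L a')).range)]
  [IsFiniteMeasure μW] hK hβK in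
set_option maxHeartbeats 1000000 in -- idem
/-- **a non-zero kernel-slice coefficient at a rational skew `S` puts `S` in the image of `Q`**: `cf_S(θ_Φ((toDiagA ·)⁻¹Γ, yΓ))(1) ≠ 0 → ∃ ξ, Q ξ = S`
(§2: otherwise every summand vanishes). [cite: KudlaRallis1994, §3] [cite: Rallis1984, §4] -/
theorem exists_index_eq_of_cf_kernel_ne_zero
    (hS : S ∈ skewMatrices ((IsCMField.complexConj L : L ≃ₐ[Fp L] L) : L →+* L) ((gramR L e dV hdV dW hdW).map (algebraMap (Fp L) L)))
    (Φ : piSchwartzBruhat (Fp L) (Fin n'')) (y : ↥(UnitaryGroup.adelic (Fp L) L (IsCMField.complexConj L) 1 (JW (Fp L) L a')))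
    (hne : fourierCoeffDelta L e dV hdV dW hdW νN βw S
        (fun h => (lineThetaKernelDatum L (n + n) e₁ (dD L e dV hdV dW hdW) (dD_conj L e dV hdV dW hdW)
            (dD_ne_zero L e dV hdV dW hdW hdV0 hdW0) lam hlam a' hρ).thetaKer Φ
          (QuotientGroup.mk (toDiagA L e dV hdV dW hdW h)⁻¹, QuotientGroup.mk y)) 1 ≠ 0) :
    ∃ ξ : Fin n'' → Fp L, Q ξ = S := by
  classical
  by_contra hall
  push Not at hall
  apply hne
  rw [cf_kernel_eq_tsum_ite L e dV hdV dW hdW e₁ hdV0 hdW0 lam hlam a' hρ νN hβ hβ0 hβtop Tg hΘ Q hmult hQskew S hS Φ y]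
  simp only [hall, if_false, tsum_zero]

set_option maxHeartbeats 1000000 in -- idem
/-- **B3-2b SUPPORT COROLLARY — a non-zero Fourier coefficient of a doubled line theta lift at a rational skew index `S` puts `S` in the image of the
multiplier index map: `cf_S(Θ̃_Φ(fw))(h) ≠ 0 → ∃ ξ, Q ξ = S`.**  ★ B3-2a `exists_cf_kernel_ne_zero_of_cf_thetaLift_ne_zero_at` (Fubini over the theta
quotient, at the Weil translate `Φ_h = ω(toDiagA h, 1)Φ`) gives a kernel slice with a non-zero coefficient at `1`; §3 at a representative of that slice.
The guard `S ∈ skewMatrices` is necessary: hermitian-type indices give the trivial character (★ `unipDeltaChar_eq_one_of_herm`).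
[cite: KudlaRallis1994, §3] [cite: Rallis1984, §4] [cite: Weil1964, Chap. III n° 41 Thm 6 p. 193] [cite: Liu2021, App. B Prop. B.8 p. 104] -/
theorem exists_index_eq_of_cf_thetaSide_ne_zero
    (hS : S ∈ skewMatrices ((IsCMField.complexConj L : L ≃ₐ[Fp L] L) : L →+* L) ((gramR L e dV hdV dW hdW).map (algebraMap (Fp L) L)))
    (Φ : piSchwartzBruhat (Fp L) (Fin n'')) (h : HA L e dV hdV dW hdW)
    (hne : fourierCoeffDelta L e dV hdV dW hdW νN βw S (doubledLineThetaLift L e dV hdV dW hdW e₁ hdV0 hdW0 lam hlam a' hρ μW Φ fw) h ≠ 0) :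
    ∃ ξ : Fin n'' → Fp L, Q ξ = S := by
  obtain ⟨q, hq⟩ := exists_cf_kernel_ne_zero_of_cf_thetaLift_ne_zero_at L e dV hdV dW hdW e₁ hdV0 hdW0 lam hlam a' hρ μW fw νN hβ hβtop hK hβK S Φ h hne
  induction q using QuotientGroup.induction_on with
  | H y => exact exists_index_eq_of_cf_kernel_ne_zero L e dV hdV dW hdW e₁ hdV0 hdW0 lam hlam a' hρ νN hβ hβ0 hβtop Tg hΘ Q hmult hQskew S hS _ y hq

set_option maxHeartbeats 1000000 in -- idem
/-- **`hsupp`, GUARDED**: the support letter of ★ B3-3 `K2LiuThetaSideRankOneIndexGlobalGram.hfib_of_indexMap` for the family `Φ ↦ Θ̃_Φ(fw)`, at every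
rational `T_L`-skew index (the only indices at which a support statement can hold). [cite: KudlaRallis1994, §3] [cite: Rallis1984, §4] -/
theorem hsupp_skew :
    ∀ S : Matrix (Fin n) (Fin n) L,
      S ∈ skewMatrices ((IsCMField.complexConj L : L ≃ₐ[Fp L] L) : L →+* L) ((gramR L e dV hdV dW hdW).map (algebraMap (Fp L) L)) →
      (∃ (Φ : piSchwartzBruhat (Fp L) (Fin n'')) (h : HA L e dV hdV dW hdW),
        fourierCoeffDelta L e dV hdV dW hdW νN βw S (doubledLineThetaLift L e dV hdV dW hdW e₁ hdV0 hdW0 lam hlam a' hρ μW Φ fw) h ≠ 0) →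
      ∃ ξ : Fin n'' → Fp L, Q ξ = S :=
  fun S hS ⟨Φ, h, hne⟩ =>
    exists_index_eq_of_cf_thetaSide_ne_zero L e dV hdV dW hdW e₁ hdV0 hdW0 lam hlam a' hρ μW fw νN hβ hβ0 hβtop hK hβK Tg hΘ Q hmult hQskew S hS Φ h hne

end Summit.HodgeConjecture.HodgeConjecture.Cruxes.HLiu418.K2LiuDoubledLineThetaCoeffUnfolding

end
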